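import Literature.Topology.FourManifolds.SpikedLoop
import HarnessLib

/-!
# A chart-straight chord in the lower neck

Topic `Literature/Topology/FourManifolds` (trunk T-4MAN). Fact seat
`provefact-Literature.Topology.FourManifolds.Knot.IsConnectedSum.isIsotopic` (Schubert's theorem),
geometric heart for rail knots, deep-chord design. The closing arcs of the foreign frames of the
final assembly must consist of material that is *exactly* in the open southern hemisphere (so
that after the reflection it is a wall of the fourth kind for the other datum), yet must contain
one chart-straight segment (host segment of the segment conjugation lemma). Model template
points are not provably south when the band touches the equator sphere to first order
(`rhoOne_nonneg` only), but true band points right of the middle line are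
(`norm_Fband_lt_two`), and the southern chart region `‖y‖ < 2` is convex. So the straight piece
is the **chord** of the lower neck between the true rail points at the blown-up parameters `5/4`
and `11/4`, spliced into the rail by a plateau bump — the construction of `SpikeModel.pieceLo`
with the chord line in place of the blown-down model path:

* `chordBump` (`1` on `[3/2, 5/2]`, `0` off `(5/4, 11/4)`), `b.chordLine κ α`
  (affine in `α`, through `railLoPsi κ (5/4)` and `railLoPsi κ (11/4)`),
  `b.chordPiece κ u α = (1 - u β α) • railLoPsi κ α + (u β α) • chordLine κ α`;
  `chordPiece_eq_rail` (off `(5/4, 11/4)`), `chordPiece_zero`, `chordPiece_one_eq_chordLine`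
  (on `[3/2, 5/2]`: exactly straight);
* flat estimates (`IsFlat`): blow-up coordinates within `4 ε` of `(α, -1, 0)`
  (`norm_blowUp_chordPiece_sub_le`), first blow-up coordinate with derivative
  `≥ 1 - ε (6 + 8 B_c)` (`hasDerivAt_blowUp_chordPiece_zero`, `B_c = chordBumpBound`), hence
  strictly increasing and injective on `[-A, A]`, regular; second coordinate `≤ -1/2`;
* the pieces are in the open southern chart ball for `α > 0` (`norm_chordPiece_lt_two`: convex
  combination of three true rail points), within `9κ‖frame‖` of `pZero` for `|α| ≤ 6`, and
  jointly `C^∞` in `(u, α)`.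

Everything is proved; no named facts are introduced.

## References

Standard; all statements `[folklore]`.
-/

open scoped Manifold ContDiff Topology Real
open Function Set Metric Filter

noncomputable section

namespace Literature.Topology.FourManifolds

/-- Local notation: `𝔼 n` is the model Euclidean space `EuclideanSpace ℝ (Fin n)`. -/
local notation "𝔼 " n:arg => EuclideanSpace ℝ (Fin n)

/-- Local notation: `𝕊 n` is the unit sphere in `EuclideanSpace ℝ (Fin (n + 1))`. -/
local notation "𝕊 " n:arg => (Metric.sphere (0 : EuclideanSpace ℝ (Fin (n + 1))) 1)

attribute [local instance] fact_finrank_euclideanSpace_succ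

open KnotsInBall

/-! ### The chord bump -/

/-- **The chord bump**: `1` on `[3/2, 5/2]`, `0` off `(5/4, 11/4)`. [folklore] -/
def chordBump (α : ℝ) : ℝ := smoothStep (5 / 4) (3 / 2) α * (1 - smoothStep (5 / 2) (11 / 4) α)

/-- The chord bump is `C^∞`. [folklore] -/
theorem contDiff_chordBump : ContDiff ℝ ∞ chordBump :=
  (contDiff_smoothStep _ _).mul (contDiff_const.sub (contDiff_smoothStep _ _))

/-- The chord bump takes values in `[0, 1]`. [folklore] -/
theorem chordBump_mem_Icc (α : ℝ) : chordBump α ∈ Icc (0 : ℝ) 1 := by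
  have h1 := smoothStep_mem_Icc (5 / 4) (3 / 2) α
  have h2 := smoothStep_mem_Icc (5 / 2) (11 / 4) α
  refine ⟨mul_nonneg h1.1 (by linarith [h2.2]), ?_⟩
  calc chordBump α ≤ 1 * 1 := mul_le_mul h1.2 (by linarith [h2.1]) (by linarith [h2.2]) zero_le_one
    _ = 1 := one_mul 1

/-- The chord bump is `1` on `[3/2, 5/2]`. [folklore] -/
theorem chordBump_eq_one {α : ℝ} (h : α ∈ Icc (3 / 2 : ℝ) (5 / 2)) : chordBump α = 1 := by
  rw [chordBump, smoothStep_of_ge (by norm_num) h.1, smoothStep_of_le (by norm_num) h.2]; ring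

/-- The chord bump vanishes left of `5/4`. [folklore] -/
theorem chordBump_eq_zero_of_le {α : ℝ} (h : α ≤ 5 / 4) : chordBump α = 0 := by
  rw [chordBump, smoothStep_of_le (by norm_num) h]; ring

/-- The chord bump vanishes right of `11/4`. [folklore] -/
theorem chordBump_eq_zero_of_ge {α : ℝ} (h : 11 / 4 ≤ α) : chordBump α = 0 := by
  rw [chordBump, smoothStep_of_ge (by norm_num) h]; ring

/-- The chord bump vanishes off `(5/4, 11/4)`. [folklore] -/
theorem chordBump_eq_zero_of_not_mem {α : ℝ} (h : α ∉ Ioo (5 / 4 : ℝ) (11 / 4)) : chordBump α = 0 := by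
  rcases le_or_gt α (5 / 4) with h1 | h1
  · exact chordBump_eq_zero_of_le h1
  · exact chordBump_eq_zero_of_ge (not_lt.1 fun h2 ↦ h ⟨h1, h2⟩)

/-- The derivative of the chord bump vanishes left of `5/4`. [folklore] -/
theorem deriv_chordBump_of_lt {α : ℝ} (h : α < 5 / 4) : deriv chordBump α = 0 := by
  have hev : chordBump =ᶠ[𝓝 α] fun _ ↦ (0 : ℝ) := by
    filter_upwards [Iio_mem_nhds h] with x hx using chordBump_eq_zero_of_le hx.le
  rw [hev.deriv_eq]; simp

/-- The derivative of the chord bump vanishes right of `11/4`. [folklore] -/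
theorem deriv_chordBump_of_gt {α : ℝ} (h : 11 / 4 < α) : deriv chordBump α = 0 := by
  have hev : chordBump =ᶠ[𝓝 α] fun _ ↦ (0 : ℝ) := by
    filter_upwards [Ioi_mem_nhds h] with x hx using chordBump_eq_zero_of_ge hx.le
  rw [hev.deriv_eq]; simp

/-- **The derivative of the chord bump is bounded.** [folklore] -/
theorem exists_deriv_chordBump_le : ∃ B' : ℝ, 0 ≤ B' ∧ ∀ α, |deriv chordBump α| ≤ B' := by
  have hc : Continuous (deriv chordBump) := contDiff_chordBump.continuous_deriv (by simp)
  obtain ⟨C, hC⟩ := (isCompact_Icc (a := (1 : ℝ)) (b := 3)).exists_bound_of_continuousOn hc.continuousOn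
  refine ⟨max C 0, le_max_right _ _, fun α ↦ ?_⟩
  by_cases hα : α ∈ Icc (1 : ℝ) 3
  · exact (Real.norm_eq_abs _ ▸ hC α hα).trans (le_max_left _ _)
  · rw [mem_Icc, not_and_or, not_le, not_le] at hα
    rcases hα with h | h
    · rw [deriv_chordBump_of_lt (by linarith), abs_zero]; exact le_max_right _ _
    · rw [deriv_chordBump_of_gt (by linarith), abs_zero]; exact le_max_right _ _

/-- **The chord bump derivative bound** (chosen). [folklore] -/
def chordBumpBound : ℝ := exists_deriv_chordBump_le.choose

/-- The chord bump derivative bound is nonnegative and bounds the derivative. [folklore] -/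
theorem chordBumpBound_spec : 0 ≤ chordBumpBound ∧ ∀ α, |deriv chordBump α| ≤ chordBumpBound :=
  exists_deriv_chordBump_le.choose_spec

/-- The chord bump has derivative `deriv chordBump α` at `α`. [folklore] -/
theorem hasDerivAt_chordBump (α : ℝ) : HasDerivAt chordBump (deriv chordBump α) α :=
  ((contDiff_chordBump.differentiable (by simp)) α).hasDerivAt

namespace BandData

variable {A B K : Knot} {avoid : Set (𝕊 3)} (b : BandData A B K avoid)
  (hcross : b.band ⁻¹' sphereEquator 2 ∩ squareNhd b.δ = {x ∈ squareNhd b.δ | x 0 = 2⁻¹})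

/-! ### The chord line and the chord piece -/

omit hcross in
/-- **The chord line**: the affine map through the true rail points at the blown-up parameters
`5/4` (at `α = 5/4`) and `11/4` (at `α = 11/4`). [folklore] -/
def chordLine (κ α : ℝ) : 𝔼 3 :=
  b.railLoPsi κ (5 / 4) + ((α - 5 / 4) * (2 / 3)) • (b.railLoPsi κ (11 / 4) - b.railLoPsi κ (5 / 4))

omit hcross in
/-- **The chord piece** (family parameter `u`, blown-up parameter `α`): the convex combination with
weight `u β α` of the rail and the chord line. [folklore] -/
def chordPiece (κ u α : ℝ) : 𝔼 3 :=
  (1 - u * chordBump α) • b.railLoPsi κ α + (u * chordBump α) • b.chordLine κ α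

omit hcross in
/-- Off `(5/4, 11/4)` the chord piece is the rail. [folklore] -/
theorem chordPiece_eq_rail {κ u α : ℝ} (h : α ∉ Ioo (5 / 4 : ℝ) (11 / 4)) : b.chordPiece κ u α = b.railLoPsi κ α := by
  simp [chordPiece, chordBump_eq_zero_of_not_mem h]

omit hcross in
/-- At `u = 0` the chord piece is the rail. [folklore] -/
@[simp] theorem chordPiece_zero (κ α : ℝ) : b.chordPiece κ 0 α = b.railLoPsi κ α := by
  simp [chordPiece]

omit hcross in
/-- **At `u = 1`, on `[3/2, 5/2]`, the chord piece is the chord line**: a straight segment of the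
chart, affine in `α`. [folklore] -/
theorem chordPiece_one_eq_chordLine {κ α : ℝ} (h : α ∈ Icc (3 / 2 : ℝ) (5 / 2)) :
    b.chordPiece κ 1 α = b.chordLine κ α := by
  simp [chordPiece, chordBump_eq_one h]

omit hcross in
/-- The chord line is affine: `chordLine α = chordLine a + (α - a)(2/3) • Δ`. [folklore] -/
theorem chordLine_eq (κ a α : ℝ) :
    b.chordLine κ α = b.chordLine κ a + ((α - a) * (2 / 3)) • (b.railLoPsi κ (11 / 4) - b.railLoPsi κ (5 / 4)) := by
  simp only [chordLine]
  module

omit hcross in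
/-- The chord line at `5/4` is the rail point there. [folklore] -/
theorem chordLine_base (κ : ℝ) : b.chordLine κ (5 / 4) = b.railLoPsi κ (5 / 4) := by
  simp [chordLine]

omit hcross in
/-- The chord line at `11/4` is the rail point there. [folklore] -/
theorem chordLine_top (κ : ℝ) : b.chordLine κ (11 / 4) = b.railLoPsi κ (11 / 4) := by
  simp only [chordLine]
  norm_num

/-! ### The blow-up coordinates of the chord piece -/

/-- **The blow-up map of a two-point affine combination.** [folklore] -/
theorem blowUp_combo (κ : ℝ) (w : ℝ) (y z : 𝔼 3) :
    b.blowUp hcross κ ((1 - w) • y + w • z) = (1 - w) • b.blowUp hcross κ y + w • b.blowUp hcross κ z := by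
  simp only [blowUp]
  have e : (1 - w) • y + w • z - b.pZero = (1 - w) • (y - b.pZero) + w • (z - b.pZero) := by module
  rw [e, map_add, map_smul, map_smul, smul_add, smul_comm κ⁻¹ (1 - w), smul_comm κ⁻¹ w]

/-- The blow-up coordinates of the chord line: the same affine combination of those of the two
rail points. [folklore] -/
theorem blowUp_chordLine (κ α : ℝ) :
    b.blowUp hcross κ (b.chordLine κ α) =
      (1 - (α - 5 / 4) * (2 / 3)) • b.blowUp hcross κ (b.railLoPsi κ (5 / 4)) +
        ((α - 5 / 4) * (2 / 3)) • b.blowUp hcross κ (b.railLoPsi κ (11 / 4)) := by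
  rw [← b.blowUp_combo hcross κ]
  congr 1
  simp only [chordLine]
  module

/-- **The blow-up coordinates of the chord piece.** [folklore] -/
theorem blowUp_chordPiece (κ u α : ℝ) :
    b.blowUp hcross κ (b.chordPiece κ u α) =
      (1 - u * chordBump α) • b.blowUp hcross κ (b.railLoPsi κ α) + (u * chordBump α) • b.blowUp hcross κ (b.chordLine κ α) :=
  b.blowUp_combo hcross κ _ _ _

/-- First blow-up coordinate of the chord piece. [folklore] -/
theorem blowUp_chordPiece_zero (κ u α : ℝ) :
    b.blowUp hcross κ (b.chordPiece κ u α) 0 =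
      (1 - u * chordBump α) * b.blowUp hcross κ (b.railLoPsi κ α) 0 + u * chordBump α * b.blowUp hcross κ (b.chordLine κ α) 0 := by
  rw [b.blowUp_chordPiece hcross]; simp

/-- Second blow-up coordinate of the chord piece. [folklore] -/
theorem blowUp_chordPiece_one (κ u α : ℝ) :
    b.blowUp hcross κ (b.chordPiece κ u α) 1 =
      (1 - u * chordBump α) * b.blowUp hcross κ (b.railLoPsi κ α) 1 + u * chordBump α * b.blowUp hcross κ (b.chordLine κ α) 1 := by
  rw [b.blowUp_chordPiece hcross]; simp

/-! ### Flat estimates -/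

section Estimates

variable {hcross} {ε r κ : ℝ} (hf : b.IsFlat hcross ε r) (hκ : 0 < κ) (h4 : κ * 4 < r)
include hf hκ h4

omit hf in
/-- The two base parameters satisfy the scale condition when `4κ < r`. [folklore] -/
theorem scale_base : κ * (|(5 / 4 : ℝ)| + 1) < r ∧ κ * (|(11 / 4 : ℝ)| + 1) < r := by
  rw [abs_of_pos (by norm_num), abs_of_pos (by norm_num)]
  constructor <;> nlinarith

/-- **The chord line in blow-up coordinates is within `4 ε` of the model line** `(α, -1, 0)` on
`[5/4, 11/4]`. [folklore] -/
theorem norm_blowUp_chordLine_sub_le {α : ℝ} (hα : α ∈ Icc (5 / 4 : ℝ) (11 / 4)) :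
    ‖b.blowUp hcross κ (b.chordLine κ α) - pt3 α (-1) 0‖ ≤ 4 * ε := by
  obtain ⟨h1, h2⟩ := scale_base hκ h4
  have e1 := b.norm_blowUp_railLoPsi_sub_le hf hκ h1
  have e2 := b.norm_blowUp_railLoPsi_sub_le hf hκ h2
  rw [abs_of_pos (by norm_num)] at e1 e2
  set w := (α - 5 / 4) * (2 / 3) with hw
  have hw0 : 0 ≤ w := by rw [hw]; nlinarith [hα.1]
  have hw1 : w ≤ 1 := by rw [hw]; nlinarith [hα.2]
  have e : b.blowUp hcross κ (b.chordLine κ α) - pt3 α (-1) 0 =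
      (1 - w) • (b.blowUp hcross κ (b.railLoPsi κ (5 / 4)) - pt3 (5 / 4) (-1) 0) +
        w • (b.blowUp hcross κ (b.railLoPsi κ (11 / 4)) - pt3 (11 / 4) (-1) 0) := by
    rw [b.blowUp_chordLine hcross]
    have hp : (pt3 α (-1) 0 : 𝔼 3) = (1 - w) • pt3 (5 / 4) (-1) 0 + w • pt3 (11 / 4) (-1) 0 := by
      ext i; fin_cases i <;> simp [hw] <;> ring
    rw [hp]; module
  rw [e]
  have hε := hf.eps_nonneg
  calc ‖(1 - w) • (b.blowUp hcross κ (b.railLoPsi κ (5 / 4)) - pt3 (5 / 4) (-1) 0) +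
        w • (b.blowUp hcross κ (b.railLoPsi κ (11 / 4)) - pt3 (11 / 4) (-1) 0)‖
      ≤ (1 - w) * ‖b.blowUp hcross κ (b.railLoPsi κ (5 / 4)) - pt3 (5 / 4) (-1) 0‖ +
          w * ‖b.blowUp hcross κ (b.railLoPsi κ (11 / 4)) - pt3 (11 / 4) (-1) 0‖ := by
        refine (norm_add_le _ _).trans ?_
        rw [norm_smul, norm_smul, Real.norm_eq_abs, Real.norm_eq_abs, abs_of_nonneg (by linarith), abs_of_nonneg hw0]
    _ ≤ (1 - w) * (ε * (5 / 4 + 1)) + w * (ε * (11 / 4 + 1)) := by gcongr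
    _ ≤ 4 * ε := by nlinarith

/-- **The chord piece in blow-up coordinates is within `4 ε` of the model line** on `[5/4, 11/4]`,
and within `ε (|α| + 1)` off it, for every `u ∈ [0, 1]`. [folklore] -/
theorem norm_blowUp_chordPiece_sub_le {u α : ℝ} (hu : u ∈ Icc (0 : ℝ) 1) (hα : κ * (|α| + 1) < r)
    (hα3 : |α| ≤ 3) : ‖b.blowUp hcross κ (b.chordPiece κ u α) - pt3 α (-1) 0‖ ≤ 4 * ε := by
  have hε := hf.eps_nonneg
  have hR := b.norm_blowUp_railLoPsi_sub_le hf hκ hα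
  have hR4 : ‖b.blowUp hcross κ (b.railLoPsi κ α) - pt3 α (-1) 0‖ ≤ 4 * ε := hR.trans (by nlinarith)
  by_cases hmem : α ∈ Ioo (5 / 4 : ℝ) (11 / 4)
  · have hC := b.norm_blowUp_chordLine_sub_le hf hκ h4 (Ioo_subset_Icc_self hmem)
    have hβ := chordBump_mem_Icc α
    have hw0 : 0 ≤ u * chordBump α := mul_nonneg hu.1 hβ.1
    have hw1 : u * chordBump α ≤ 1 := mul_le_one₀ hu.2 hβ.1 hβ.2
    set w := u * chordBump α
    have e : b.blowUp hcross κ (b.chordPiece κ u α) - pt3 α (-1) 0 =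
        (1 - w) • (b.blowUp hcross κ (b.railLoPsi κ α) - pt3 α (-1) 0) +
          w • (b.blowUp hcross κ (b.chordLine κ α) - pt3 α (-1) 0) := by
      rw [b.blowUp_chordPiece hcross]; module
    rw [e]
    calc ‖(1 - w) • (b.blowUp hcross κ (b.railLoPsi κ α) - pt3 α (-1) 0) + w • (b.blowUp hcross κ (b.chordLine κ α) - pt3 α (-1) 0)‖
        ≤ (1 - w) * ‖b.blowUp hcross κ (b.railLoPsi κ α) - pt3 α (-1) 0‖ + w * ‖b.blowUp hcross κ (b.chordLine κ α) - pt3 α (-1) 0‖ := by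
          refine (norm_add_le _ _).trans ?_
          rw [norm_smul, norm_smul, Real.norm_eq_abs, Real.norm_eq_abs, abs_of_nonneg (by linarith), abs_of_nonneg hw0]
      _ ≤ (1 - w) * (4 * ε) + w * (4 * ε) := by gcongr
      _ = 4 * ε := by ring
  · rw [b.chordPiece_eq_rail hmem]; exact hR4

/-- Coordinates of the chord piece: `|Y₀ - α|, |Y₁ + 1|, |Y₂| ≤ 4 ε`. [folklore] -/
theorem blowUp_chordPiece_coord {u α : ℝ} (hu : u ∈ Icc (0 : ℝ) 1) (hα : κ * (|α| + 1) < r) (hα3 : |α| ≤ 3) :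
    |b.blowUp hcross κ (b.chordPiece κ u α) 0 - α| ≤ 4 * ε ∧
      |b.blowUp hcross κ (b.chordPiece κ u α) 1 + 1| ≤ 4 * ε ∧
        |b.blowUp hcross κ (b.chordPiece κ u α) 2| ≤ 4 * ε := by
  have h := b.norm_blowUp_chordPiece_sub_le hf hκ h4 hu hα hα3
  refine ⟨?_, ?_, ?_⟩
  · have := (BandFoliation.abs_apply_le_norm _ 0).trans h; simpa using this
  · have := (BandFoliation.abs_apply_le_norm _ 1).trans h; simpa [sub_neg_eq_add] using this
  · have := (BandFoliation.abs_apply_le_norm _ 2).trans h; simpa using this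

/-- **The slope of the chord line in blow-up coordinates**: its first coordinate is within `6 ε` of
`1`, the full vector within `6 ε` of `(1, 0, 0)`. [folklore] -/
theorem norm_chordSlope_sub_le :
    ‖(2 / 3 : ℝ) • (b.blowUp hcross κ (b.railLoPsi κ (11 / 4)) - b.blowUp hcross κ (b.railLoPsi κ (5 / 4))) - pt3 1 0 0‖ ≤ 6 * ε := by
  obtain ⟨h1, h2⟩ := scale_base hκ h4
  have e1 := b.norm_blowUp_railLoPsi_sub_le hf hκ h1
  have e2 := b.norm_blowUp_railLoPsi_sub_le hf hκ h2
  rw [abs_of_pos (by norm_num)] at e1 e2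
  have e : (2 / 3 : ℝ) • (b.blowUp hcross κ (b.railLoPsi κ (11 / 4)) - b.blowUp hcross κ (b.railLoPsi κ (5 / 4))) - pt3 1 0 0 =
      (2 / 3 : ℝ) • ((b.blowUp hcross κ (b.railLoPsi κ (11 / 4)) - pt3 (11 / 4) (-1) 0) -
        (b.blowUp hcross κ (b.railLoPsi κ (5 / 4)) - pt3 (5 / 4) (-1) 0)) := by
    have hp : (pt3 1 0 0 : 𝔼 3) = (2 / 3 : ℝ) • (pt3 (11 / 4) (-1) 0 - pt3 (5 / 4) (-1) 0) := by
      ext i; fin_cases i <;> norm_num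
    rw [hp]; module
  rw [e, norm_smul, Real.norm_eq_abs, abs_of_pos (by norm_num)]
  have := norm_sub_le (b.blowUp hcross κ (b.railLoPsi κ (11 / 4)) - pt3 (11 / 4) (-1) 0)
    (b.blowUp hcross κ (b.railLoPsi κ (5 / 4)) - pt3 (5 / 4) (-1) 0)
  nlinarith [hf.eps_nonneg]

omit hf hκ h4 in
/-- **The chord line in blow-up coordinates has a derivative**, the chord slope. [folklore] -/
theorem hasDerivAt_blowUp_chordLine (α : ℝ) :
    HasDerivAt (fun a ↦ b.blowUp hcross κ (b.chordLine κ a))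
      ((2 / 3 : ℝ) • (b.blowUp hcross κ (b.railLoPsi κ (11 / 4)) - b.blowUp hcross κ (b.railLoPsi κ (5 / 4)))) α := by
  have e : (fun a ↦ b.blowUp hcross κ (b.chordLine κ a)) = fun a ↦
      b.blowUp hcross κ (b.railLoPsi κ (5 / 4)) +
        ((a - 5 / 4) * (2 / 3)) • (b.blowUp hcross κ (b.railLoPsi κ (11 / 4)) - b.blowUp hcross κ (b.railLoPsi κ (5 / 4))) := by
    funext a
    rw [b.blowUp_chordLine hcross]; module
  rw [e]
  have h1 : HasDerivAt (fun a : ℝ ↦ (a - 5 / 4) * (2 / 3)) (1 * (2 / 3)) α := ((hasDerivAt_id α).sub_const _).mul_const _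
  have h2 := h1.smul_const (b.blowUp hcross κ (b.railLoPsi κ (11 / 4)) - b.blowUp hcross κ (b.railLoPsi κ (5 / 4)))
  rw [one_mul] at h2
  exact h2.const_add _

/-- **Derivative of the first blow-up coordinate of the chord piece**, with the lower bound
`1 - ε (6 + 8 B_c)` for `u ∈ [0, 1]` and `|α| ≤ 3`. [folklore] -/
theorem hasDerivAt_blowUp_chordPiece_zero {u α : ℝ} (hu : u ∈ Icc (0 : ℝ) 1) (hα : κ * (|α| + 1) < r) (hα3 : |α| ≤ 3) :
    ∃ g' : ℝ, HasDerivAt (fun a ↦ b.blowUp hcross κ (b.chordPiece κ u a) 0) g' α ∧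
      1 - ε * (6 + 8 * chordBumpBound) ≤ g' := by
  obtain ⟨V, hV, hVb⟩ := b.hasDerivAt_blowUp_railLoPsi hf hκ hα
  set R : ℝ → ℝ := fun a ↦ b.blowUp hcross κ (b.railLoPsi κ a) 0 with hR
  set C : ℝ → ℝ := fun a ↦ b.blowUp hcross κ (b.chordLine κ a) 0 with hC
  set S : 𝔼 3 := (2 / 3 : ℝ) • (b.blowUp hcross κ (b.railLoPsi κ (11 / 4)) - b.blowUp hcross κ (b.railLoPsi κ (5 / 4))) with hS
  have hR' : HasDerivAt R (V 0) α := by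
    have := ((EuclideanSpace.proj (0 : Fin 3) : 𝔼 3 →L[ℝ] ℝ).hasFDerivAt).comp_hasDerivAt α hV
    exact this
  have hC' : HasDerivAt C (S 0) α := by
    have := ((EuclideanSpace.proj (0 : Fin 3) : 𝔼 3 →L[ℝ] ℝ).hasFDerivAt).comp_hasDerivAt α (b.hasDerivAt_blowUp_chordLine (hcross := hcross) (κ := κ) α)
    exact this
  have hβ := hasDerivAt_chordBump α
  have e : (fun a ↦ b.blowUp hcross κ (b.chordPiece κ u a) 0) =
      fun a ↦ (1 - u * chordBump a) * R a + u * chordBump a * C a := by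
    funext a; rw [b.blowUp_chordPiece_zero hcross]
  have h1 : HasDerivAt (fun a ↦ (1 - u * chordBump a) * R a)
      ((-(u * deriv chordBump α)) * R α + (1 - u * chordBump α) * V 0) α :=
    (((hβ.const_mul u).const_sub 1).mul hR').congr_deriv (by ring)
  have h2 : HasDerivAt (fun a ↦ u * chordBump a * C a) (u * deriv chordBump α * C α + u * chordBump α * S 0) α :=
    (hβ.const_mul u).mul hC'
  refine ⟨_, by rw [e]; exact h1.add h2, ?_⟩
  -- the bound
  obtain ⟨hB0, hB⟩ := chordBumpBound_spec
  have hβ01 := chordBump_mem_Icc α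
  have hVb0 : |V 0 - 1| ≤ ε := by
    have := (BandFoliation.abs_apply_le_norm (V - pt3 1 0 0) 0).trans hVb; simpa using this
  have hS0 : |S 0 - 1| ≤ 6 * ε := by
    have := (BandFoliation.abs_apply_le_norm (S - pt3 1 0 0) 0).trans (b.norm_chordSlope_sub_le hf hκ h4); simpa using this
  have hR0 : |R α - α| ≤ 4 * ε := by
    have := (b.blowUp_railLoPsi_coord hf hκ hα).1
    exact this.trans (by nlinarith [hf.eps_nonneg])
  have hε := hf.eps_nonneg
  have hw0 : 0 ≤ u * chordBump α := mul_nonneg hu.1 hβ01.1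
  have hw1 : u * chordBump α ≤ 1 := mul_le_one₀ hu.2 hβ01.1 hβ01.2
  have hd : |deriv chordBump α| ≤ chordBumpBound := hB α
  -- on the support of the bump the chord line is close to the model line, hence to the rail
  have hCR : |u * deriv chordBump α * (C α - R α)| ≤ chordBumpBound * (8 * ε) := by
    by_cases hmem : α ∈ Ioo (5 / 4 : ℝ) (11 / 4)
    · have hC0 : |C α - α| ≤ 4 * ε := by
        have := (BandFoliation.abs_apply_le_norm (b.blowUp hcross κ (b.chordLine κ α) - pt3 α (-1) 0) 0).trans
          (b.norm_blowUp_chordLine_sub_le hf hκ h4 (Ioo_subset_Icc_self hmem))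
        simpa using this
      have hCR' : |C α - R α| ≤ 8 * ε := by
        have e2 : C α - R α = (C α - α) - (R α - α) := by ring
        rw [e2]; exact (abs_sub _ _).trans (by linarith)
      rw [abs_mul, abs_mul, abs_of_nonneg hu.1]
      calc u * |deriv chordBump α| * |C α - R α| ≤ 1 * chordBumpBound * (8 * ε) := by
            apply mul_le_mul _ hCR' (abs_nonneg _) (mul_nonneg zero_le_one hB0)
            exact mul_le_mul hu.2 hd (abs_nonneg _) zero_le_one
        _ = chordBumpBound * (8 * ε) := by ring
    · rcases le_or_gt α (5 / 4) with hle | hgt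
      · rcases hle.eq_or_lt with heq | hlt
        · rw [heq]
          have : C (5 / 4) - R (5 / 4) = 0 := by simp only [hC, hR, b.chordLine_base]; ring
          rw [this, mul_zero, abs_zero]; positivity
        · rw [deriv_chordBump_of_lt hlt]; simp only [mul_zero, zero_mul, abs_zero]; positivity
      · have hge : 11 / 4 ≤ α := not_lt.1 fun h' ↦ hmem ⟨hgt, h'⟩
        rcases hge.eq_or_lt with heq | hlt
        · rw [← heq]
          have : C (11 / 4) - R (11 / 4) = 0 := by simp only [hC, hR, b.chordLine_top]; ring
          rw [this, mul_zero, abs_zero]; positivity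
        · rw [deriv_chordBump_of_gt hlt]; simp only [mul_zero, zero_mul, abs_zero]; positivity
  -- `g' = (1 - w) V₀ + w S₀ + u β' (C - R)`
  have eg : (-(u * deriv chordBump α)) * R α + (1 - u * chordBump α) * V 0 +
      (u * deriv chordBump α * C α + u * chordBump α * S 0) =
      (1 - u * chordBump α) * V 0 + u * chordBump α * S 0 + u * deriv chordBump α * (C α - R α) := by ring
  rw [eg]
  have t1 : (1 - u * chordBump α) * (1 - ε) ≤ (1 - u * chordBump α) * V 0 := by
    apply mul_le_mul_of_nonneg_left _ (by linarith)
    linarith [(abs_le.1 hVb0).1]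
  have t2 : u * chordBump α * (1 - 6 * ε) ≤ u * chordBump α * S 0 := by
    apply mul_le_mul_of_nonneg_left _ hw0
    linarith [(abs_le.1 hS0).1]
  have t3 : -(chordBumpBound * (8 * ε)) ≤ u * deriv chordBump α * (C α - R α) := by linarith [(abs_le.1 hCR).1]
  have t4 : u * chordBump α * ε ≤ ε := by nlinarith
  nlinarith [t1, t2, t3, t4, hw0, hw1, hε]

/-- **The first blow-up coordinate of the chord piece is strictly increasing on `[-3, 3]`** when
`ε (6 + 8 B_c) ≤ 1/2`. [folklore] -/
theorem strictMonoOn_blowUp_chordPiece_zero {u : ℝ} (hu : u ∈ Icc (0 : ℝ) 1)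
    (hgood : ε * (6 + 8 * chordBumpBound) ≤ 1 / 2) :
    StrictMonoOn (fun a ↦ b.blowUp hcross κ (b.chordPiece κ u a) 0) (Icc (-3) 3) := by
  have hder : ∀ a ∈ Icc (-3 : ℝ) 3, ∃ g', HasDerivAt (fun a ↦ b.blowUp hcross κ (b.chordPiece κ u a) 0) g' a ∧ 1 / 2 ≤ g' := by
    intro a ha
    have ha3 : |a| ≤ 3 := abs_le.2 ⟨ha.1, ha.2⟩
    obtain ⟨g', hg', hb⟩ := b.hasDerivAt_blowUp_chordPiece_zero hf hκ h4 hu (by nlinarith) ha3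
    exact ⟨g', hg', by linarith⟩
  refine strictMonoOn_of_deriv_pos (convex_Icc _ _) (fun a ha ↦ ?_) (fun a ha ↦ ?_)
  · obtain ⟨g', hg', -⟩ := hder a ha
    exact hg'.continuousAt.continuousWithinAt
  · obtain ⟨g', hg', hb⟩ := hder a (interior_subset ha)
    rw [hg'.deriv]; linarith

/-- **The chord piece is injective on `[-3, 3]`.** [folklore] -/
theorem injOn_chordPiece {u : ℝ} (hu : u ∈ Icc (0 : ℝ) 1) (hgood : ε * (6 + 8 * chordBumpBound) ≤ 1 / 2) :
    InjOn (b.chordPiece κ u) (Icc (-3) 3) := fun a ha a' ha' h ↦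
  (b.strictMonoOn_blowUp_chordPiece_zero hf hκ h4 hu hgood).injOn ha ha' (by simp only [h])

/-- **The chord piece is regular**: a derivative vector is nonzero (`|α| ≤ 3`). [folklore] -/
theorem ne_zero_of_hasDerivAt_chordPiece {u α : ℝ} (hu : u ∈ Icc (0 : ℝ) 1) (hα3 : |α| ≤ 3)
    (hgood : ε * (6 + 8 * chordBumpBound) ≤ 1 / 2) {W : 𝔼 3}
    (hW : HasDerivAt (b.chordPiece κ u) W α) : W ≠ 0 := by
  intro hW0
  obtain ⟨g', hg', hb⟩ := b.hasDerivAt_blowUp_chordPiece_zero hf hκ h4 hu (by nlinarith) hα3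
  have h1 : HasDerivAt (fun a ↦ b.blowUp hcross κ (b.chordPiece κ u a)) ((b.frame hcross).symm (κ⁻¹ • W)) α :=
    b.hasDerivAt_blowUp_comp hκ (by rwa [smul_smul, mul_inv_cancel₀ hκ.ne', one_smul])
  have h2 : HasDerivAt (fun a ↦ b.blowUp hcross κ (b.chordPiece κ u a) 0) (((b.frame hcross).symm (κ⁻¹ • W)) 0) α :=
    ((EuclideanSpace.proj (0 : Fin 3) : 𝔼 3 →L[ℝ] ℝ).hasFDerivAt).comp_hasDerivAt α h1
  have h3 := hg'.unique h2
  rw [hW0, smul_zero, map_zero] at h3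
  have : (1 : ℝ) / 2 ≤ g' := by linarith
  rw [h3] at this
  simp at this
  linarith

/-- **The second blow-up coordinate of the chord piece is `≤ -1/2`** (`ε ≤ 1/8`, `|α| ≤ 3`).
[folklore] -/
theorem blowUp_chordPiece_one_le {u α : ℝ} (hu : u ∈ Icc (0 : ℝ) 1) (hα : κ * (|α| + 1) < r) (hα3 : |α| ≤ 3)
    (hε : ε ≤ 1 / 8) : b.blowUp hcross κ (b.chordPiece κ u α) 1 ≤ -(1 / 2) := by
  have h := (b.blowUp_chordPiece_coord hf hκ h4 hu hα hα3).2.1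
  linarith [(abs_le.1 h).2]

/-- The first blow-up coordinate of the chord piece is at least `α - 4 ε` (`|α| ≤ 3`). [folklore] -/
theorem blowUp_chordPiece_zero_ge {u α : ℝ} (hu : u ∈ Icc (0 : ℝ) 1) (hα : κ * (|α| + 1) < r) (hα3 : |α| ≤ 3) :
    α - 4 * ε ≤ b.blowUp hcross κ (b.chordPiece κ u α) 0 := by
  have h := (b.blowUp_chordPiece_coord hf hκ h4 hu hα hα3).1
  linarith [(abs_le.1 h).1]

/-- **The chord piece stays within blow-up norm `|α| + 2`** (`ε ≤ 1/4`, `|α| ≤ 3`). [folklore] -/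
theorem norm_blowUp_chordPiece_le {u α : ℝ} (hu : u ∈ Icc (0 : ℝ) 1) (hα : κ * (|α| + 1) < r) (hα3 : |α| ≤ 3)
    (hε : ε ≤ 1 / 4) : ‖b.blowUp hcross κ (b.chordPiece κ u α)‖ ≤ |α| + 2 := by
  have h := b.norm_blowUp_chordPiece_sub_le hf hκ h4 hu hα hα3
  have h0 : ‖(pt3 α (-1) 0 : 𝔼 3)‖ ≤ |α| + 1 := (norm_pt3_le _ _ _).trans (by simp)
  have := norm_sub_norm_le (b.blowUp hcross κ (b.chordPiece κ u α)) (pt3 α (-1) 0)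
  linarith

/-- **The chord piece is within `9κ ‖frame‖` of `pZero`** (`ε ≤ 1/4`, `|α| ≤ 3`). [folklore] -/
theorem norm_chordPiece_sub_pZero_le {u α : ℝ} (hu : u ∈ Icc (0 : ℝ) 1) (hα : κ * (|α| + 1) < r) (hα3 : |α| ≤ 3)
    (hε : ε ≤ 1 / 4) :
    ‖b.chordPiece κ u α - b.pZero‖ ≤ 9 * κ * ‖((b.frame hcross : (𝔼 3) ≃L[ℝ] 𝔼 3) : (𝔼 3) →L[ℝ] 𝔼 3)‖ := by
  have h1 := b.norm_sub_pZero_le hκ (hcross := hcross) (b.chordPiece κ u α)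
  have h2 := b.norm_blowUp_chordPiece_le hf hκ h4 hu hα hα3 hε
  calc _ ≤ κ * ‖((b.frame hcross : (𝔼 3) ≃L[ℝ] 𝔼 3) : (𝔼 3) →L[ℝ] 𝔼 3)‖ * ‖b.blowUp hcross κ (b.chordPiece κ u α)‖ := h1
    _ ≤ κ * ‖((b.frame hcross : (𝔼 3) ≃L[ℝ] 𝔼 3) : (𝔼 3) →L[ℝ] 𝔼 3)‖ * 9 :=
        mul_le_mul_of_nonneg_left (by linarith) (mul_nonneg hκ.le (norm_nonneg _))
    _ = _ := by ring

end Estimates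

/-! ### The chord piece is south -/

include hcross in
/-- **The rail point at a positive blown-up parameter is in the open southern chart ball**
(`‖railLoPsi κ α‖ < 2` for `0 < κ α`, `κ (|α| + 1) < 1/2`). [folklore] -/
theorem norm_railLoPsi_lt_two (hB : B.InSouth) {κ α : ℝ} (hκ : 0 < κ) (hα : 0 < α) (hsc : κ * (|α| + 1) < 2⁻¹) :
    ‖b.railLoPsi κ α‖ < 2 := by
  have hq : ‖(pt2 (κ * α) (-κ) : 𝔼 2)‖ < 2⁻¹ := by
    have := norm_railParam_le hκ α (-1) (by simp)
    rw [neg_one_mul] at this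
    exact this.trans_lt hsc
  exact b.norm_Fband_lt_two (hcross := hcross) hB hq (by simpa using mul_pos hκ hα)

include hcross in
/-- **The chord piece is in the open southern chart ball** for `α > 0`, `u ∈ [0, 1]`
(`4κ < 1/2`, `κ (|α| + 1) < 1/2`): a convex combination of three southern rail points. [folklore] -/
theorem norm_chordPiece_lt_two (hB : B.InSouth) {κ u α : ℝ} (hκ : 0 < κ) (hκ8 : κ * 4 < 2⁻¹) (hu : u ∈ Icc (0 : ℝ) 1)
    (hα : 0 < α) (hsc : κ * (|α| + 1) < 2⁻¹) : ‖b.chordPiece κ u α‖ < 2 := by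
  have hRα := b.norm_railLoPsi_lt_two hcross hB hκ hα hsc
  by_cases hmem : α ∈ Ioo (5 / 4 : ℝ) (11 / 4)
  · have hR1 : ‖b.railLoPsi κ (5 / 4)‖ < 2 :=
      b.norm_railLoPsi_lt_two hcross hB hκ (by norm_num) (by rw [abs_of_pos (by norm_num)]; nlinarith)
    have hR2 : ‖b.railLoPsi κ (11 / 4)‖ < 2 :=
      b.norm_railLoPsi_lt_two hcross hB hκ (by norm_num) (by rw [abs_of_pos (by norm_num)]; nlinarith)
    have hβ := chordBump_mem_Icc α
    have hw0 : 0 ≤ u * chordBump α := mul_nonneg hu.1 hβ.1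
    have hw1 : u * chordBump α ≤ 1 := mul_le_one₀ hu.2 hβ.1 hβ.2
    set w := u * chordBump α
    set lam := (α - 5 / 4) * (2 / 3) with hlam
    have hl0 : 0 ≤ lam := by rw [hlam]; nlinarith [hmem.1]
    have hl1 : lam ≤ 1 := by rw [hlam]; nlinarith [hmem.2]
    have e : b.chordPiece κ u α = (1 - w) • b.railLoPsi κ α + (w * (1 - lam)) • b.railLoPsi κ (5 / 4) +
        (w * lam) • b.railLoPsi κ (11 / 4) := by
      simp only [chordPiece, chordLine, hlam]; module
    rw [e]
    have n1 : ‖(1 - w) • b.railLoPsi κ α‖ = (1 - w) * ‖b.railLoPsi κ α‖ := by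
      rw [norm_smul, Real.norm_eq_abs, abs_of_nonneg (by linarith)]
    have n2 : ‖(w * (1 - lam)) • b.railLoPsi κ (5 / 4)‖ = w * (1 - lam) * ‖b.railLoPsi κ (5 / 4)‖ := by
      rw [norm_smul, Real.norm_eq_abs, abs_of_nonneg (mul_nonneg hw0 (by linarith))]
    have n3 : ‖(w * lam) • b.railLoPsi κ (11 / 4)‖ = w * lam * ‖b.railLoPsi κ (11 / 4)‖ := by
      rw [norm_smul, Real.norm_eq_abs, abs_of_nonneg (mul_nonneg hw0 hl0)]
    calc ‖(1 - w) • b.railLoPsi κ α + (w * (1 - lam)) • b.railLoPsi κ (5 / 4) + (w * lam) • b.railLoPsi κ (11 / 4)‖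
        ≤ ‖(1 - w) • b.railLoPsi κ α‖ + ‖(w * (1 - lam)) • b.railLoPsi κ (5 / 4)‖ + ‖(w * lam) • b.railLoPsi κ (11 / 4)‖ :=
          (norm_add_le _ _).trans (add_le_add (norm_add_le _ _) le_rfl)
      _ = (1 - w) * ‖b.railLoPsi κ α‖ + w * (1 - lam) * ‖b.railLoPsi κ (5 / 4)‖ + w * lam * ‖b.railLoPsi κ (11 / 4)‖ := by
          rw [n1, n2, n3]
      _ < 2 := by
          rcases hw0.eq_or_lt with hw | hw
          · rw [← hw]; simp only [sub_zero, one_mul, zero_mul, add_zero]; exact hRα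
          · have h1 : (1 - w) * ‖b.railLoPsi κ α‖ ≤ (1 - w) * 2 := mul_le_mul_of_nonneg_left hRα.le (by linarith)
            have h2 : w * (1 - lam) * ‖b.railLoPsi κ (5 / 4)‖ + w * lam * ‖b.railLoPsi κ (11 / 4)‖ < w * 2 := by
              rcases hl0.eq_or_lt with hl | hl
              · rw [← hl]; simp only [sub_zero, mul_one, mul_zero, zero_mul, add_zero]
                exact mul_lt_mul_of_pos_left hR1 hw
              · have h3 : w * (1 - lam) * ‖b.railLoPsi κ (5 / 4)‖ ≤ w * (1 - lam) * 2 :=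
                  mul_le_mul_of_nonneg_left hR1.le (mul_nonneg hw0 (by linarith))
                have h4 : w * lam * ‖b.railLoPsi κ (11 / 4)‖ < w * lam * 2 :=
                  mul_lt_mul_of_pos_left hR2 (mul_pos hw hl)
                nlinarith
            linarith
  · rw [b.chordPiece_eq_rail hmem]; exact hRα

include hcross in
/-- **The chord piece on the sphere is in the open southern hemisphere** (same hypotheses).
[folklore] -/
theorem coe_psiN_symm_chordPiece_last_neg (hB : B.InSouth) {κ u α : ℝ} (hκ : 0 < κ) (hκ8 : κ * 4 < 2⁻¹)
    (hu : u ∈ Icc (0 : ℝ) 1) (hα : 0 < α) (hsc : κ * (|α| + 1) < 2⁻¹) :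
    ((psiN.symm (b.chordPiece κ u α) : 𝕊 3) : 𝔼 4) (Fin.last 3) < 0 := by
  have h := b.norm_chordPiece_lt_two hcross hB hκ hκ8 hu hα hsc
  rw [← psiN_apply_psiN_symm (b.chordPiece κ u α)] at h
  exact (norm_psiN_lt_two_iff (psiN_symm_ne_northPole _)).1 h

/-! ### Smoothness of the chord piece -/

/-- **The chord piece is jointly `C^∞`** in `(u, α)` wherever the rail parameter point is within
the pole-free radius. [folklore] -/
theorem contDiffAt_chordPiece {κ : ℝ} {u α : ℝ}
    (hα : ‖(pt2 (κ * α) (-κ) : 𝔼 2)‖ < b.poleRad hcross) :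
    ContDiffAt ℝ ∞ (uncurry (b.chordPiece κ)) (u, α) := by
  have hR : ContDiffAt ℝ ∞ (fun p : ℝ × ℝ ↦ b.railLoPsi κ p.2) (u, α) := by
    have h1 : ContDiffAt ℝ ∞ (b.railLoPsi κ) α := by
      have hq : ContDiff ℝ ∞ (fun a : ℝ ↦ (pt2 (κ * a) (-κ) : 𝔼 2)) := by
        rw [contDiff_euclidean]; intro i; fin_cases i
        · exact contDiff_const.mul contDiff_id
        · exact contDiff_const
      exact (b.contDiffAt_Fband hcross hα).comp α hq.contDiffAt
    exact ContDiffAt.comp (g := b.railLoPsi κ) (f := Prod.snd) (u, α) h1 contDiffAt_snd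
  have hβ : ContDiffAt ℝ ∞ (fun p : ℝ × ℝ ↦ p.1 * chordBump p.2) (u, α) :=
    contDiffAt_fst.mul (contDiff_chordBump.contDiffAt.comp (u, α) contDiffAt_snd)
  have hL : ContDiffAt ℝ ∞ (fun p : ℝ × ℝ ↦ b.chordLine κ p.2) (u, α) := by
    have h1 : ContDiff ℝ ∞ (b.chordLine κ) := by
      unfold chordLine
      exact contDiff_const.add (((contDiff_id.sub contDiff_const).mul contDiff_const).smul contDiff_const)
    exact ContDiffAt.comp (g := b.chordLine κ) (f := Prod.snd) (u, α) h1.contDiffAt contDiffAt_snd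
  have e : uncurry (b.chordPiece κ) = fun p : ℝ × ℝ ↦
      (1 - p.1 * chordBump p.2) • b.railLoPsi κ p.2 + (p.1 * chordBump p.2) • b.chordLine κ p.2 := by
    funext p; rfl
  rw [e]
  exact ((contDiffAt_const.sub hβ).smul hR).add (hβ.smul hL)

end BandData

end Literature.Topology.FourManifolds
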